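import Literature.MathematicalPhysics.QuantumFieldTheory.Balaban1983to89.B9Eq347LocalFromBlockDecay

/-!
# `Balaban1983to89.B9Eq347LocalLetterAdjoint` — T. Bałaban, *Propagators for lattice gauge theories in a background field*, Commun. Math. Phys. **99**
# (1985) 389–434 [Balaban1985BackgroundPropagators] Thm 3.1 (3.42) p. 397 against (3.49) p. 399 (the same decay in the two currencies: pointwise on blocks,
# and as bounds on the block pieces `1_{Δ(y)}T1_{Δ(y′)}` in the weighted `L²` norms (3.11) p. 392) and p. 391 *«The adjoints are taken with respect to
# natural L² scalar products»* (the words (3.123)∕(3.153) pp. 420∕426 contain the adjoints `Q*`, `Q′*`, `D*` of their finite-range factors): **THE LOCAL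
# LETTER (L) ⟹ BLOCK DECAY IN `L²` (the converse of this lineage's `B9Eq347LocalFromBlockDecay`), AND HENCE (L) IS STABLE UNDER THE `L²`-ADJOINT —
# `‖1_{Δ(v)}T†1_{Δ(u)}‖ = ‖(1_{Δ(u)}T1_{Δ(v)})†‖ = ‖1_{Δ(u)}T1_{Δ(v)}‖`: (L)(T; B, κ) ⟹ `‖P′_u∘T∘P_v‖ ≤ B·√(μ′∕ω)·e^{−κδ(u,v)}` ⟹ (L)(T†; B·μ′∕ω, κ)** (`μ′` = the
# weighted mass of an output block of `T`, `ω` = the least source weight of `T`; on the fine torus with constant weights `μ′∕ω = L^d`) — so the adjoint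
# factors of the words enter the sup-norm algebra of `B9Eq347LocalLetterAlgebra` from the letters of `Q′`, `D`, … themselves, at a price print allows at
# one step («B₀ depends on d and L», p. 398) (pub-balaban NE9 owner's SUP-NORM PROGRAMME plan v10 §6 OPEN (4))

statement-level skeleton of published theorems with citation tags; proofs where landed; nothing here is a claim about the Yang–Mills mass gap

CITATION HEADER (lean-in-tree rule).  Audit cell `pub-balaban`, sub-cell `t4`, BINDER row NE9; filed by NE9 crux-team LEAF PROVER 03
(`b2b-balaban-t4-ne9-formalise-leaf-03`, gen 71).  Composed BY NAME: the cell's weighted carrier `B9Eq311L2Pairing.WL2` (`norm_sq`, `weight_mul_norm_sq_apply_le`),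
ne9-leaf-01's (K1) block-family LETTER and `B9Eq349BlockMultipliers.norm_sq_block_apply` ∕ `norm_block_apply_le`, Mathlib's `ContinuousLinearMap.adjoint`
(`adjoint_comp`, the isometry `‖T†‖ = ‖T‖`); the self-adjointness of the block multipliers is a DISPLAYED hypothesis (supplier: ne9-leaf-01's
`B9Eq349KWAssembly.adjoint_eq_self_of_pointwise`).  Sources READ (renders `…1985-cmp99-background-propagators-p003∕p009∕p011`): [Balaban1985BackgroundPropagators]
p. 391 (the sentence on adjoints), p. 397 (3.42), p. 398 (the sentence on `B₀`), p. 399 (3.49).  NOTHING printed is asserted.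

WHAT IS PROVED (sorry-free; proof lane — no `def`; [folklore]).  Abstract data as in `B9Eq347LocalFromBlockDecay` §1 (finite `X`, `X′`, positive weights
`w`, `w′`, block maps `π`, `π′ : _ → Y`, block families `P`, `P′` by their (K1) letters, any `δ`, `T : L²_w(X;V) →L L²_{w′}(X′;W)`, finite-dimensional
fibres):
* §1 **`block_decay_of_local`** — (L)(T; B, κ) read through `WL2.equiv` (the `hloc` shape of `B9Eq347GlobalFromLocal.local_transport`), `ω ≤ w`, output block
  masses `Σ_{π′x=u} w′(x) ≤ μ′` ⟹ `‖P′_u ∘ T ∘ P_v‖ ≤ (B·√μ′∕√ω)·e^{−κδ(u,v)}` — the `hdec` shape of the cell ((3.49)'s currency from (3.42)'s).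
* §2 **`opNorm_block_adjoint_block`** (`‖P_v ∘ T† ∘ P′_u‖ = ‖P′_u ∘ T ∘ P_v‖` for self-adjoint block families); **`local_adjoint`** — (L)(T; B, κ), `δ`
  symmetric ⟹ (L)(T†; B·μ′∕ω, κ) through `WL2.equiv` (§1, the adjoint identity, and `B9Eq347LocalFromBlockDecay.local_of_block_decay` with the roles of
  the carriers exchanged: `(B√μ′∕√ω)·(√μ′∕√ω)`).
* §3 **`local_adjoint_sites`** — the fine torus `T_{(L·m)}`, both carriers `SiteL2K ℂ d (fineP L m) c₀ W`, `π = π′ = blockCoord L m`, `δ = d_m`: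
  (L)(T; B, κ) ⟹ (L)(T†; B·L^d, κ).
HONEST SCOPE.  Currency changes only; the factor `μ′∕ω` (`= L^d` on the fine torus) is the honest price of passing a SUP letter through the `L²` adjoint
and back — for a concrete factor (`Q′*`, `D*`) a direct pointwise letter is sharper (`B9Eq33CovDerivLocalLetter.local_covDiv` has no `L^d`); the abstract
route is for factors given only through `LinearMap.adjoint` (the tree's `Q′(U)†` inside `laplacePrimeA`).  NOT (3.42), NOT NE9 (cell pub-balaban: NE9 NOT
PRINTED ∕ NOT PROVED; «NE9 ⇐ the named binders»; row WALLED ON A MODEL (O-NE9-1; #5 UNRULED); spine PROVED 0∕9; rung (B)+1 on a finite T⁴ — NOT infinite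
volume, NOT mass gap, NOT Clay; HONEST DEPENDENCY: continuum YM on T⁴ ⇐ BetaPertH ∧ nine spine estimates (0/9 proved); BetaPertH ⇐ (D1) ∧ (D4) ∧ CAP+tail;
G-an2-4 gates asym, D1 and NE2/3/4).  NEW file importing this lineage's `B9Eq347LocalFromBlockDecay` (filed this gen; the file lands when that module's hub olean exists);
nothing modified.  Net new unproved facts: 0.
-/

noncomputable section

open scoped BigOperators

namespace Literature.MathematicalPhysics.QuantumFieldTheory.Balaban1983to89.B9Eq347LocalLetterAdjoint

open B4Sect5Torus (TSite tdist tdist_symm)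
open B9Eq311L2Pairing (WL2)
open B9Eq319QprimeTorus (fineP blockCoord)
open B11Eq103H1Complex (SiteL2K)
open B9Eq349BlockMultipliers (norm_sq_block_apply norm_block_apply_le)
open B9Eq349BlockDecayFromKernel (card_sites_block_le)

/-! ## §1 From the local sup letter to block decay in `L²_w → L²_{w′}` -/

section Abstract

variable {𝕜 : Type*} [RCLike 𝕜] {X X' Y : Type*} [Fintype X] [Fintype X'] [DecidableEq Y]
  {w : X → ℝ} {w' : X' → ℝ} [Fact (∀ x, 0 < w x)] [Fact (∀ x, 0 < w' x)]
  {V W : Type*} [NormedAddCommGroup V] [InnerProductSpace 𝕜 V] [NormedAddCommGroup W] [InnerProductSpace 𝕜 W]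
  {π : X → Y} {π' : X' → Y}
  {P : Y → WL2 𝕜 w V →L[𝕜] WL2 𝕜 w V} {P' : Y → WL2 𝕜 w' W →L[𝕜] WL2 𝕜 w' W}
  (hP : ∀ (y : Y) (f : WL2 𝕜 w V) (x : X), WL2.equiv 𝕜 w V (P y f) x = if π x = y then WL2.equiv 𝕜 w V f x else 0)
  (hP' : ∀ (y : Y) (g : WL2 𝕜 w' W) (x : X'), WL2.equiv 𝕜 w' W (P' y g) x = if π' x = y then WL2.equiv 𝕜 w' W g x else 0)

include hP hP' in
/-- **THE LOCAL LETTER ⟹ BLOCK DECAY IN `L²`** ((3.42)'s currency ⟹ (3.49)'s): if `T` obeys (L)(T; B, κ) through `WL2.equiv` (`0 ≤ B`), the source weights are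
`≥ ω > 0` and the output blocks have weighted mass `≤ μ′`, then `‖P′_u ∘ T ∘ P_v‖ ≤ (B·√μ′∕√ω)·e^{−κδ(u,v)}`: for `f ∈ L²_w`, `g := P_vf` is supported in
`π⁻¹(v)` with `‖g(y)‖ ≤ ‖f‖∕√ω`, so `‖(Tg)(x)‖ ≤ B·e^{−κδ(π′x,v)}·‖f‖∕√ω`, and `‖P′_u(Tg)‖² = Σ_{π′x=u} w′(x)‖(Tg)(x)‖² ≤ μ′·(B·e^{−κδ(u,v)}·‖f‖∕√ω)²`.
[folklore] [cite: Balaban1985BackgroundPropagators, Thm 3.1 (3.42) p.397, (3.49) p.399, (3.11) p.392] -/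
theorem block_decay_of_local (T : WL2 𝕜 w V →L[𝕜] WL2 𝕜 w' W) (δ : Y → Y → ℝ) {B κ μ' ω : ℝ} (hB : 0 ≤ B) (hω : 0 < ω)
    (hw : ∀ y, ω ≤ w y) (hμ' : ∀ u, ∑ x, (if π' x = u then w' x else 0) ≤ μ')
    (hloc : ∀ (v : Y) (f : WL2 𝕜 w V) (F : ℝ), (∀ y, π y ≠ v → WL2.equiv 𝕜 w V f y = 0) → (∀ y, ‖WL2.equiv 𝕜 w V f y‖ ≤ F) →
      ∀ x, ‖WL2.equiv 𝕜 w' W (T f) x‖ ≤ B * Real.exp (-(κ * δ (π' x) v)) * F)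
    (u v : Y) : ‖P' u ∘L T ∘L P v‖ ≤ B * Real.sqrt μ' / Real.sqrt ω * Real.exp (-(κ * δ u v)) := by
  have hw0 : ∀ x, 0 < w x := Fact.out
  have hw'0 : ∀ x, 0 < w' x := Fact.out
  have hsω : 0 < Real.sqrt ω := Real.sqrt_pos.2 hω
  have hμ'0 : 0 ≤ μ' := by
    rcases isEmpty_or_nonempty Y with hY | ⟨⟨u₀⟩⟩
    · exact (IsEmpty.false u).elim
    · exact (Finset.sum_nonneg fun x _ => by
        by_cases hx : π' x = u
        · rw [if_pos hx]; exact (hw'0 x).le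
        · rw [if_neg hx]).trans (hμ' u)
  have hC : 0 ≤ B * Real.sqrt μ' / Real.sqrt ω * Real.exp (-(κ * δ u v)) := by positivity
  refine ContinuousLinearMap.opNorm_le_bound _ hC fun f => ?_
  -- `g := P_v f`: supported in the block `v`, pointwise bounded by `‖f‖ ∕ √ω`
  have hgv : ∀ y, π y ≠ v → WL2.equiv 𝕜 w V (P v f) y = 0 := fun y hy => by rw [hP, if_neg hy]
  have hgF : ∀ y, ‖WL2.equiv 𝕜 w V (P v f) y‖ ≤ ‖f‖ / Real.sqrt ω := fun y => by
    rw [le_div_iff₀ hsω]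
    have h1 : w y * ‖WL2.equiv 𝕜 w V (P v f) y‖ ^ 2 ≤ ‖P v f‖ ^ 2 := WL2.weight_mul_norm_sq_apply_le (P v f) y
    have h2 : ‖P v f‖ ≤ ‖f‖ := norm_block_apply_le hP v f
    have h3 : (‖WL2.equiv 𝕜 w V (P v f) y‖ * Real.sqrt ω) ^ 2 ≤ ‖f‖ ^ 2 := by
      calc (‖WL2.equiv 𝕜 w V (P v f) y‖ * Real.sqrt ω) ^ 2 = ω * ‖WL2.equiv 𝕜 w V (P v f) y‖ ^ 2 := by
            rw [mul_pow, Real.sq_sqrt hω.le]; ring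
        _ ≤ w y * ‖WL2.equiv 𝕜 w V (P v f) y‖ ^ 2 := mul_le_mul_of_nonneg_right (hw y) (sq_nonneg _)
        _ ≤ ‖f‖ ^ 2 := h1.trans (pow_le_pow_left₀ (norm_nonneg _) h2 2)
    have h4 := Real.sqrt_le_sqrt h3
    rwa [Real.sqrt_sq (mul_nonneg (norm_nonneg _) hsω.le), Real.sqrt_sq (norm_nonneg _)] at h4
  -- the pointwise bound on `T g` and the block-`u` mass
  have hpt : ∀ x, ‖WL2.equiv 𝕜 w' W (T (P v f)) x‖ ≤ B * Real.exp (-(κ * δ (π' x) v)) * (‖f‖ / Real.sqrt ω) :=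
    hloc v (P v f) _ hgv hgF
  set R : ℝ := B * Real.exp (-(κ * δ u v)) * (‖f‖ / Real.sqrt ω) with hRdef
  have hR : 0 ≤ R := mul_nonneg (mul_nonneg hB (Real.exp_nonneg _)) (div_nonneg (norm_nonneg _) hsω.le)
  have hsq : ‖P' u (T (P v f))‖ ^ 2 ≤ μ' * R ^ 2 := by
    rw [norm_sq_block_apply hP' u (T (P v f))]
    calc ∑ x, (if π' x = u then w' x * ‖WL2.equiv 𝕜 w' W (T (P v f)) x‖ ^ 2 else 0)
        ≤ ∑ x, (if π' x = u then w' x else 0) * R ^ 2 := by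
          refine Finset.sum_le_sum fun x _ => ?_
          by_cases hx : π' x = u
          · rw [if_pos hx, if_pos hx]
            refine mul_le_mul_of_nonneg_left (pow_le_pow_left₀ (norm_nonneg _) ?_ 2) (hw'0 x).le
            have h := hpt x
            rwa [hx] at h
          · rw [if_neg hx, if_neg hx, zero_mul]
      _ = (∑ x, if π' x = u then w' x else 0) * R ^ 2 := by rw [Finset.sum_mul]
      _ ≤ μ' * R ^ 2 := mul_le_mul_of_nonneg_right (hμ' u) (sq_nonneg R)
  have hfin : ‖P' u (T (P v f))‖ ≤ Real.sqrt μ' * R := by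
    have h := Real.sqrt_le_sqrt hsq
    rwa [Real.sqrt_sq (norm_nonneg _), Real.sqrt_mul hμ'0, Real.sqrt_sq hR] at h
  calc ‖(P' u ∘L T ∘L P v) f‖ = ‖P' u (T (P v f))‖ := by rw [ContinuousLinearMap.comp_apply, ContinuousLinearMap.comp_apply]
    _ ≤ Real.sqrt μ' * R := hfin
    _ = B * Real.sqrt μ' / Real.sqrt ω * Real.exp (-(κ * δ u v)) * ‖f‖ := by rw [hRdef]; ring

/-! ## §2 The adjoint -/

variable [FiniteDimensional 𝕜 V] [FiniteDimensional 𝕜 W]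

omit [DecidableEq Y] in
/-- **BLOCK PIECES OF THE ADJOINT**: for self-adjoint block families, `‖P_v ∘ T† ∘ P′_u‖ = ‖P′_u ∘ T ∘ P_v‖` (`(P′_uTP_v)† = P_vT†P′_u` and the adjoint is an
isometry). [folklore] [cite: Balaban1985BackgroundPropagators, p.391 «The adjoints are taken with respect to natural L² scalar products», (3.49) p.399] -/
theorem opNorm_block_adjoint_block (T : WL2 𝕜 w V →L[𝕜] WL2 𝕜 w' W) (hPadj : ∀ y, ContinuousLinearMap.adjoint (P y) = P y)
    (hP'adj : ∀ y, ContinuousLinearMap.adjoint (P' y) = P' y) (u v : Y) :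
    ‖P v ∘L ContinuousLinearMap.adjoint T ∘L P' u‖ = ‖P' u ∘L T ∘L P v‖ := by
  have h : P v ∘L ContinuousLinearMap.adjoint T ∘L P' u = ContinuousLinearMap.adjoint (P' u ∘L T ∘L P v) := by
    rw [ContinuousLinearMap.adjoint_comp, ContinuousLinearMap.adjoint_comp, hPadj, hP'adj, ContinuousLinearMap.comp_assoc]
  rw [h]
  exact LinearIsometryEquiv.norm_map _ _

include hP hP' in
/-- **THE LOCAL LETTER IS STABLE UNDER THE `L²`-ADJOINT**: (L)(T; B, κ) through `WL2.equiv`, `δ` symmetric, self-adjoint block families, source weights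
`≥ ω > 0`, output block masses `≤ μ′` ⟹ (L)(T†; B·μ′∕ω, κ) through `WL2.equiv` — §1 gives the block decay of `T`, the adjoint identity transports it to `T†`,
and `B9Eq347LocalFromBlockDecay.local_of_block_decay` (with the carriers exchanged: source `L²_{w′}`, blocks `P′`; target `L²_w`, blocks `P`) reads it
pointwise. The price `μ′∕ω` is honest (`L^d` on the fine torus); a concrete adjoint with a pointwise formula does better. [folklore]
[cite: Balaban1985BackgroundPropagators, Thm 3.1 (3.42) p.397, (3.49) p.399, p.391] -/
theorem local_adjoint [Nonempty X] [Nonempty X'] (T : WL2 𝕜 w V →L[𝕜] WL2 𝕜 w' W) (δ : Y → Y → ℝ) (hδs : ∀ u v, δ u v = δ v u)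
    (hPadj : ∀ y, ContinuousLinearMap.adjoint (P y) = P y) (hP'adj : ∀ y, ContinuousLinearMap.adjoint (P' y) = P' y)
    {B κ μ' ω : ℝ} (hB : 0 ≤ B) (hω : 0 < ω) (hw : ∀ y, ω ≤ w y) (hμ' : ∀ u, ∑ x, (if π' x = u then w' x else 0) ≤ μ')
    (hloc : ∀ (v : Y) (f : WL2 𝕜 w V) (F : ℝ), (∀ y, π y ≠ v → WL2.equiv 𝕜 w V f y = 0) → (∀ y, ‖WL2.equiv 𝕜 w V f y‖ ≤ F) →
      ∀ x, ‖WL2.equiv 𝕜 w' W (T f) x‖ ≤ B * Real.exp (-(κ * δ (π' x) v)) * F)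
    (u : Y) (g : WL2 𝕜 w' W) (F : ℝ) (hgu : ∀ x, π' x ≠ u → WL2.equiv 𝕜 w' W g x = 0) (hgF : ∀ x, ‖WL2.equiv 𝕜 w' W g x‖ ≤ F) (y : X) :
    ‖WL2.equiv 𝕜 w V (ContinuousLinearMap.adjoint T g) y‖ ≤ B * Real.sqrt μ' / Real.sqrt ω * Real.sqrt μ' / Real.sqrt ω *
      Real.exp (-(κ * δ (π y) u)) * F := by
  have hdec : ∀ a b : Y, ‖P a ∘L ContinuousLinearMap.adjoint T ∘L P' b‖ ≤ B * Real.sqrt μ' / Real.sqrt ω * Real.exp (-(κ * δ a b)) := by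
    intro a b
    rw [opNorm_block_adjoint_block T hPadj hP'adj b a, hδs a b]
    exact block_decay_of_local hP hP' T δ hB hω hw hμ' hloc b a
  have hC : 0 ≤ B * Real.sqrt μ' / Real.sqrt ω := by positivity
  have h := B9Eq347LocalFromBlockDecay.local_of_block_decay hP' hP (ContinuousLinearMap.adjoint T) δ hC hω hw hμ' hdec u g F hgu hgF y
  calc _ ≤ B * Real.sqrt μ' / Real.sqrt ω * Real.sqrt μ' / Real.sqrt ω * Real.exp (-(κ * δ (π y) u)) * F := h

end Abstract

/-! ## §3 The fine torus with constant weights: `μ′∕ω = L^d` -/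

section Lattice

variable {d : ℕ} {L : ℕ} [NeZero L] {m : Fin d → ℕ} {c₀ : ℝ} [Fact (0 < c₀)]
  {W : Type*} [NormedAddCommGroup W] [InnerProductSpace ℂ W] [FiniteDimensional ℂ W]

/-- **ON THE FINE TORUS** (`SiteL2K ℂ d (fineP L m) c₀ W` on both sides, blocks of `blockCoord L m`, `δ = d_m`, self-adjoint block family `P`): (L)(T; B, κ)
⟹ (L)(T†; B·L^d, κ) — the adjoint factors `Q′(U)†`, … of the words (3.123)∕(3.153) inherit the letter at the one-step price `L^d`.
[folklore] [cite: Balaban1985BackgroundPropagators, Thm 3.1 (3.42) p.397, (3.49) p.399, p.398 «B₀ depends on d and L»] -/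
theorem local_adjoint_sites (hm : ∀ i, 1 ≤ m i) (T : SiteL2K ℂ d (fineP L m) c₀ W →L[ℂ] SiteL2K ℂ d (fineP L m) c₀ W)
    {P : TSite d m → SiteL2K ℂ d (fineP L m) c₀ W →L[ℂ] SiteL2K ℂ d (fineP L m) c₀ W}
    (hP : ∀ (y : TSite d m) (f : SiteL2K ℂ d (fineP L m) c₀ W) (x : TSite d (fineP L m)),
      WL2.equiv ℂ (fun _ : TSite d (fineP L m) => c₀) W (P y f) x =
        if blockCoord L m x = y then WL2.equiv ℂ (fun _ : TSite d (fineP L m) => c₀) W f x else 0)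
    (hPadj : ∀ y, ContinuousLinearMap.adjoint (P y) = P y) {B κ : ℝ} (hB : 0 ≤ B)
    (hloc : ∀ (v : TSite d m) (f : SiteL2K ℂ d (fineP L m) c₀ W) (F : ℝ),
      (∀ y, blockCoord L m y ≠ v → WL2.equiv ℂ (fun _ : TSite d (fineP L m) => c₀) W f y = 0) →
      (∀ y, ‖WL2.equiv ℂ (fun _ : TSite d (fineP L m) => c₀) W f y‖ ≤ F) →
      ∀ x, ‖WL2.equiv ℂ (fun _ : TSite d (fineP L m) => c₀) W (T f) x‖ ≤ B * Real.exp (-(κ * tdist m (blockCoord L m x) v)) * F)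
    (u : TSite d m) (g : SiteL2K ℂ d (fineP L m) c₀ W) (F : ℝ)
    (hgu : ∀ x, blockCoord L m x ≠ u → WL2.equiv ℂ (fun _ : TSite d (fineP L m) => c₀) W g x = 0)
    (hgF : ∀ x, ‖WL2.equiv ℂ (fun _ : TSite d (fineP L m) => c₀) W g x‖ ≤ F) (y : TSite d (fineP L m)) :
    ‖WL2.equiv ℂ (fun _ : TSite d (fineP L m) => c₀) W (ContinuousLinearMap.adjoint T g) y‖ ≤
      B * (L : ℝ) ^ d * Real.exp (-(κ * tdist m (blockCoord L m y) u)) * F := by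
  have hc₀ : 0 < c₀ := Fact.out
  haveI : Nonempty (TSite d (fineP L m)) := ⟨y⟩
  have hμ : ∀ a : TSite d m, ∑ x : TSite d (fineP L m), (if blockCoord L m x = a then c₀ else 0) ≤ c₀ * (L : ℝ) ^ d := fun a => by
    classical
    rw [← Finset.sum_filter, Finset.sum_const, nsmul_eq_mul, mul_comm]
    exact mul_le_mul_of_nonneg_left (by exact_mod_cast card_sites_block_le (L := L) (m := m) a) hc₀.le
  have h := local_adjoint hP hP T (tdist m) (fun a b => tdist_symm hm a b) hPadj hPadj hB hc₀ (fun _ => le_rfl) hμ hloc u g F hgu hgF y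
  calc _ ≤ B * Real.sqrt (c₀ * (L : ℝ) ^ d) / Real.sqrt c₀ * Real.sqrt (c₀ * (L : ℝ) ^ d) / Real.sqrt c₀ *
        Real.exp (-(κ * tdist m (blockCoord L m y) u)) * F := h
    _ = B * (L : ℝ) ^ d * Real.exp (-(κ * tdist m (blockCoord L m y) u)) * F := by
        have hs : Real.sqrt (c₀ * (L : ℝ) ^ d) / Real.sqrt c₀ = Real.sqrt ((L : ℝ) ^ d) := by
          rw [Real.sqrt_mul hc₀.le, mul_div_right_comm, div_self (Real.sqrt_pos.2 hc₀).ne', one_mul]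
        have hLd : 0 ≤ (L : ℝ) ^ d := by positivity
        have key : B * Real.sqrt (c₀ * (L : ℝ) ^ d) / Real.sqrt c₀ * Real.sqrt (c₀ * (L : ℝ) ^ d) / Real.sqrt c₀ = B * (L : ℝ) ^ d := by
          calc B * Real.sqrt (c₀ * (L : ℝ) ^ d) / Real.sqrt c₀ * Real.sqrt (c₀ * (L : ℝ) ^ d) / Real.sqrt c₀
              = B * ((Real.sqrt (c₀ * (L : ℝ) ^ d) / Real.sqrt c₀) * (Real.sqrt (c₀ * (L : ℝ) ^ d) / Real.sqrt c₀)) := by ring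
            _ = B * (L : ℝ) ^ d := by rw [hs, Real.mul_self_sqrt hLd]
        rw [key]

end Lattice

end Literature.MathematicalPhysics.QuantumFieldTheory.Balaban1983to89.B9Eq347LocalLetterAdjoint

end
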